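import Mathlib
import Literature.MathematicalPhysics.QuantumFieldTheory.Balaban1983to89.B16Cor3Wilson
import Literature.MathematicalPhysics.QuantumFieldTheory.Balaban1983to89.TreeLengthTorus

/-!
# `Balaban1983to89.B16Cor3Torus` — the Cor 3 chain ((2.50) [III] / (0.1) of [Balaban1989LargeFieldII], one run, one
step) with its GEOMETRY hypotheses DISCHARGED on the papers' periodic carrier: the localization domains of the current
step (reading (α)) and of every age (reading (β)) realised as the TORUS catalogues `TreeLengthTorus.tsys 4 N`, the
degree bound `Δ = 8` and the volume leaf `c₀ = 64` PROVED there (`tdegreeLE`, `tvolumeLeaf`), the reserved tree-decay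
rate `κ₁ ≥ κ₀(64, 8) = 64 log 162` (`TreeLengthCubeSystem.kappa₀_four`), and the cube count `|π_k| ≤ πc·|T₁^{(k)}|` REPLACED by the tiling identity of [I]
(0.26) p. 257 (`πc = M⁻⁴`; for the ages `m = k − j` of reading (β): `|π_j| = Λ^{m}·M⁻⁴·|T₁^{(k)}|`, `Λ = L⁴`)

CITATION HEADER (lean-in-tree rule 2026-08-18).  Source under audit: T. Bałaban, *Large field renormalization. II.
Localization, exponentiation, and bounds for the 𝐑 operation*, Commun. Math. Phys. **122**, 355–392 (1989),
doi:10.1007/bf01238433 [Balaban1989LargeFieldII] (cell paper B16 = [V]; held: `paper:balaban1989-cmp122-large-field-ii`;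
journal page = PDF page + 354; the sentence of p. 387 quoted below is read from the render
`HOME/b2b-balaban-ref1/pages/1989-cmp122-large-field-II/1989-cmp122-large-field-II-p033-x2.png`), with [I] = T. Bałaban,
*Renormalization group approach to lattice gauge field theories. I. Generation of effective actions in a small field
approximation and a coupling constant renormalization in four dimensions*, Commun. Math. Phys. **109**, 249–301 (1987)
[Balaban1987RG1] (cell paper B12; journal page = PDF page + 248; (0.1) p. 251 and (0.26) p. 257 read from the renders
`…/1987-cmp109-rg-I-small-field/1987-cmp109-rg-I-small-field-p003-x2.png`, `…-p009-x2.png`) and [III] = T. Bałaban,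
*Convergent renormalization expansions for lattice gauge theories*, Commun. Math. Phys. **119**, 243–285 (1988)
[Balaban1988Convergent] ((2.50) p. 264).  Sixth module of the surge-node lineage `B14Cor3` (gen 1: (2.50) ⇐ five named
leaves) → `B16Cor3` (gen 2) → `B16Cor3Scales` (gen 3: readings (α)/(β) of the live regions, tree decay discharged BY
NAME from `B12TreeDecay.hTree_of_volumeLeaf` over an ABSTRACT `CubeSystem` with hypotheses `hΔ`, `hV`, `hπ`) →
`B16Cor3Ops` (gen 4) → `B16Cor3Wilson` (gen 5) → here (gen 6: the abstract cube systems of gens 3–5 INSTANTIATED by the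
torus catalogues of `TreeLengthTorus` (unit pv22 gen 2), whose degree bound, volume leaf and cube count are kernel
theorems).  Cell records: GAPS C-adv3-6 (the volume reading `|T_η| = |T₁^{(k)}|`), G-pv06-1 (B) / C-B16-9 (k-uniformity
of the entropy constant), DIVERGENCE D-pv22.3 (window versus torus); unit `b2b-balaban-pv06` gen 6 (surge node prover
#06), journal claim B16-COR3-TORUS-KERNEL.  No existing module is modified; everything is composed BY NAME.

(a) THE PRINTED TEXT.  [I] p. 257 [9], verbatim: *"We decompose the space T into the lattice of closed cubes of a size
M, where M = L^m, with centers at points of the lattice T_M^{(j+m)}. … We denote this family of cubes by π_j"* — the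
space T being the TORUS of p. 251 [3]: *"a torus T obtained by the usual identification of boundary points of the cube
{x ∈ R^d : −L_μ ≦ x_μ ≦ L_μ, μ = 1, …, d}. We take L_μ = L^m"*, (0.1): *"T_ε = {x ∈ εZ^d + Σ_{μ=1}^{d} ½εe_μ : −L_μ < x_μ <
L_μ, μ = 1, …, d}, with a lattice spacing ε = L^{−K}. This torus determines a sequence of tori denoted by T^{(k)}_{L^kε}
and defined by (0.1) with ε replaced by L^kε, k = 1, 2, …"* — and (0.26) p. 257: *"≦ Σ_{j=1}^{k} Σ_{□∈π_j} Σ_{X∈𝐃_j, X⊃□}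
E₀ exp(−κd_j(X)) ≦ Σ_{j=1}^{k} Σ_{□∈π_j} E₀O(1) = Σ_{j=1}^{k} E₀O(1)M^{−4}|T_1^{(j)}| ≦ E₀O(1)M^{−4}|T_1^{(k)}|η^{−4},
η = L^{−k}. (0.26)"*, i.e. `|π_j| = M^{−4}|T_1^{(j)}|` (the M-cubes tile the torus) and `|T_1^{(j)}| = L^{4(k−j)}|T_1^{(k)}|`.
[V] p. 387 [33], verbatim: *"Next, we have noticed already that the inequality (1.79) holds for the 𝐓-operation
connected with an arbitrary large field region. The inequality (1.80) holds quite generally for such regions, hence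
also an improved bound (1.89), with the additional term −κ₁d_k(X) in the exponential. This implies the inequality
(2.50) [III], hence Corollary 3."*  The quotations behind the other hypotheses of the chain ((1.72), (1.73), (1.89),
(1.98)–(1.100), [III] (2.19), (2.23), (2.49), [IV] pp. 200–201) are in the docstrings of the imported lineage modules
and are not repeated.

(b) THE TYPED READING.  Gens 3–5 stated (2.50)/(0.1) for one run and one step over an abstract system of localization
domains `S : LocDomainSys` with an abstract `G : B12TreeDecay.CubeSystem S` and the three geometric hypotheses `hΔ :
G.DegreeLE Δ` (every cube has at most Δ wall-neighbours), `hV : G.VolumeLeaf c₀` (|X|_M ≤ c₀(1 + d_k(X))) and `hπ :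
|cubes| ≤ πc·|T₁^{(k)}|`.  On the papers' own carrier — the torus with `N` M-cubes per direction, `TreeLengthTorus.tsys 4 N`
/ `tcubeSys 4 N` — the first two are THEOREMS (`tdegreeLE 4 N : DegreeLE (2·4)`, `tvolumeLeaf 4 N : VolumeLeaf
(4·2^4)`), and the third is the IDENTITY `|π| = N⁴ = M⁻⁴(M·N)⁴` (`card_tcube_eq_inv_pow`) together with the tiling
relation `|T₁^{(k)}| = (M·N)⁴` between the abstract site count `B12.RunData.numSites` of the run and the torus — kept
as the hypothesis `hnum`, exactly as in `TreeLengthTorus.uvStable030_of_thm1_torus` (T09.1 on the torus); for the ages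
of reading (β) the cubes per direction satisfy `N_{k−m} ≤ L^m·N_k` (equality for the lattices of (0.1) [I]:
`ncubes_eq_pow_mul` from `TreeLengthTorus.sitesPerDir_eq_pow_mul`), whence `|π_j| ≤ M⁻⁴·(L⁴)^{m}·|T₁^{(k)}|`
(`cubeCount_scales_torus`).  §1 proves these counts; §2 is reading (α) on the torus: `uvIneq_of_structure_classes_torus`
(gen 3), `uvIneq_of_repr172_torus` (gen 4), `uvIneq_of_repr172_wilson_torus` / `uvIneq_of_repr172_wilsonSplit_torus` (gen
5) — the SAME statements with `(S, G, hΔ, hV, hκ, πc, hπ)` replaced by `(N, M, hnum, κ₁ ≥ κ₀(64,8))` and the constant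
`E₊ = E′ (+ ε′) + M⁻⁴·K₀(64,8)·Σ_i e^{−c_i}`, `K₀(c₀,Δ) = e^{κ₀(c₀,Δ)}(Δ+1)⁻²` (`B12TreeDecay.K₀`); §3 is reading (β) on the
tori of all ages: `uvIneq_of_structure_scales_torus`, `uvIneq_of_structure_horizon_torus` with `E₊ = E′ + EpScales M⁻⁴
64 8 q` (k-UNIFORM).  After this module the hypotheses left in the chain are the analytic / printed leaves ((1.72) holds
for the density, the characteristic functions, the factor leaves or the Wilson mechanism, the curly bracket, (1.100)
summed, the lower (2.49) bookkeeping, leaf U1 for reading (β)) and run data (`hnum`, the cubes per direction) — NO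
geometric hypothesis.  Every proof is a one-line application of the lineage theorem to the torus data.

(c) VALUE.  Kernel bookkeeping: the geometric side of Corollary 3's entropy estimate is discharged on the printed
carrier with explicit dimension-only constants (Δ = 8, c₀ = 64, κ₀(64,8) = 64 log 162, πc = M⁻⁴, Λ = L⁴).  NOT summit
progress: (1.72), (1.79)/(1.89), (1.98)–(1.100) and Theorem 1's hypothesis remain exactly as open as before.
-/

noncomputable section

namespace Literature.MathematicalPhysics.QuantumFieldTheory.Balaban1983to89.B16Cor3Torus

open Literature.MathematicalPhysics.QuantumFieldTheory.Balaban1983to89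
open Literature.MathematicalPhysics.QuantumFieldTheory.Balaban1983to89.TreeLengthTorus
open Literature.MathematicalPhysics.QuantumFieldTheory.Balaban1983to89.B16Cor3Ops
open Literature.MathematicalPhysics.QuantumFieldTheory.Balaban1983to89.B16Cor3Wilson

/-! ## 1. The torus data: decidable equality of domains, the cube counts |π_k| = N⁴ = M⁻⁴|T₁^{(k)}| and |π_j| ≤ Λ^{k−j}M⁻⁴|T₁^{(k)}| -/

/-- Equality of torus localization domains (finite families of cubes of (ℤ/N)^d) is decidable — the instance the
Wilson-form theorems of gen 5 ask of the domain type (`[DecidableEq S.Dom]`). [folklore] -/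
instance instDecidableEqDom (d N : ℕ) [NeZero N] : DecidableEq (tsys d N).Dom := fun X Y =>
  decidable_of_iff (X.1 = Y.1) Subtype.ext_iff.symm

/-- |π| = N⁴ for the torus with N cubes per direction (d = 4), for the cube cover underlying `tcubeSys 4 N`.
[cite: Balaban1987RG1, (0.26) p.257] -/
theorem card_cubes_torus (N : ℕ) [NeZero N] :
    (Fintype.card (tcubeSys 4 N).toCubeCover.Cube : ℝ) = (N : ℝ) ^ 4 := by
  have h : Fintype.card (tcubeSys 4 N).toCubeCover.Cube = N ^ 4 := card_tcube 4 N
  rw [h]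
  push_cast
  rfl

/-- **The cube count `hπ` of the chain ON THE TORUS** — [I] (0.26) p. 257 *"Σ_{□∈π_j} E₀O(1) = … E₀O(1)M^{−4}|T_1^{(j)}|"*:
if the M-cubes tile the lattice, `|T₁^{(k)}| = (M·N)⁴` (`hnum`), then `|π_k| ≤ M⁻⁴·|T₁^{(k)}|` (with equality,
`TreeLengthTorus.card_tcube_eq_inv_pow`). [cite: Balaban1987RG1, (0.26) p.257] -/
theorem cubeCount_torus (N : ℕ) [NeZero N] {M : ℝ} (hM : M ≠ 0) {Ns : ℝ} (hnum : Ns = (M * N) ^ 4) :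
    (Fintype.card (tcubeSys 4 N).toCubeCover.Cube : ℝ) ≤ M⁻¹ ^ 4 * Ns := by
  rw [hnum]
  exact (card_tcube_eq_inv_pow 4 N hM).le

/-- **The cube counts of all ages ON THE TORI** — [I] (0.26) p. 257 *"Σ_{j=1}^{k} E₀O(1)M^{−4}|T_1^{(j)}| ≦
E₀O(1)M^{−4}|T_1^{(k)}|η^{−4}, η = L^{−k}"*: if the torus of age `m` (scale `j = k − m`) has `N_m ≤ L^m·N_0` cubes per
direction and `|T₁^{(k)}| = (M·N_0)⁴`, then `|π_{k−m}| ≤ M⁻⁴·(L⁴)^m·|T₁^{(k)}|` — the hypothesis `hπ` of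
`B16Cor3Scales.uvIneq_of_structure_scales` with `πc = M⁻⁴`, `Λ = L⁴`. [cite: Balaban1987RG1, (0.26) p.257] -/
theorem cubeCount_scales_torus {k : ℕ} (Nc : Fin (k + 1) → ℕ) [∀ m, NeZero (Nc m)] {M L : ℝ} (hM : M ≠ 0)
    {Ns : ℝ} (hnum : Ns = (M * Nc 0) ^ 4) (hN : ∀ m, (Nc m : ℝ) ≤ L ^ (m : ℕ) * Nc 0) (m : Fin (k + 1)) :
    (Fintype.card (tcubeSys 4 (Nc m)).toCubeCover.Cube : ℝ) ≤ M⁻¹ ^ 4 * (L ^ 4) ^ (m : ℕ) * Ns := by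
  rw [card_cubes_torus, hnum]
  have h0 : (0 : ℝ) ≤ Nc m := Nat.cast_nonneg _
  calc ((Nc m : ℕ) : ℝ) ^ 4 ≤ (L ^ (m : ℕ) * Nc 0) ^ 4 := pow_le_pow_left₀ h0 (hN m) 4
    _ = (L ^ (m : ℕ) * Nc 0) ^ 4 * (M⁻¹ * M) ^ 4 := by rw [inv_mul_cancel₀ hM, one_pow, mul_one]
    _ = M⁻¹ ^ 4 * (L ^ 4) ^ (m : ℕ) * (M * Nc 0) ^ 4 := by ring

/-- **The cubes per direction of the tori of (0.1) [I]** — p. 251: *"This torus determines a sequence of tori denoted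
by T^{(k)}_{L^kε} and defined by (0.1) with ε replaced by L^kε"* (typed in `Setup` as `Params.sitesPerDir j =
2L^{m+K−j}` sites per direction): if the torus of age `m` has `N_m` M-cubes per direction with `M·N_m = ` sites per
direction of `T^{(k−m)}`, then `N_m = L^m·N_0` (from `TreeLengthTorus.sitesPerDir_eq_pow_mul`) — the equality case of
the hypothesis `hN` of `cubeCount_scales_torus`. [cite: Balaban1987RG1, (0.1) p.251] -/
theorem ncubes_eq_pow_mul (P : Params) {k : ℕ} (hk : k ≤ P.m + P.K) (Nc : Fin (k + 1) → ℕ) {M : ℝ} (hM : M ≠ 0)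
    (hNc : ∀ m : Fin (k + 1), M * (Nc m : ℝ) = (P.sitesPerDir (k - m) : ℝ)) (m : Fin (k + 1)) :
    (Nc m : ℝ) = (P.L : ℝ) ^ (m : ℕ) * Nc 0 := by
  have h := sitesPerDir_eq_pow_mul P (Nat.sub_le k m) hk
  have hkm : k - (k - (m : ℕ)) = m := by have := m.2; omega
  rw [hkm] at h
  have h0 : M * (Nc 0 : ℝ) = (P.sitesPerDir k : ℝ) := by simpa using hNc 0
  apply mul_left_cancel₀ hM
  calc M * (Nc m : ℝ) = (P.sitesPerDir (k - m) : ℝ) := hNc m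
    _ = (P.L : ℝ) ^ (m : ℕ) * (P.sitesPerDir k : ℝ) := by rw [h]; push_cast; ring
    _ = (P.L : ℝ) ^ (m : ℕ) * (M * Nc 0) := by rw [h0]
    _ = M * ((P.L : ℝ) ^ (m : ℕ) * Nc 0) := by ring

/-- The hypothesis `hN` of `cubeCount_scales_torus` for the tori of (0.1) [I] (equality). [cite: Balaban1987RG1, (0.1) p.251] -/
theorem ncubes_le_pow_mul (P : Params) {k : ℕ} (hk : k ≤ P.m + P.K) (Nc : Fin (k + 1) → ℕ) {M : ℝ} (hM : M ≠ 0)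
    (hNc : ∀ m : Fin (k + 1), M * (Nc m : ℝ) = (P.sitesPerDir (k - m) : ℝ)) (m : Fin (k + 1)) :
    (Nc m : ℝ) ≤ (P.L : ℝ) ^ (m : ℕ) * Nc 0 :=
  (ncubes_eq_pow_mul P hk Nc hM hNc m).le

/-! ## 2. Reading (α) on the torus: gens 3, 4, 5 with the geometry discharged -/

/-- **(2.50)/(0.1), one run, one step, reading (α), ON THE TORUS** — `B16Cor3Scales.uvIneq_of_structure_classes` with
the localization domains of step k realised as the torus catalogue `tsys 4 N` (N M-cubes per direction), the degree
bound and the volume leaf DISCHARGED (`tdegreeLE`: Δ = 8; `tvolumeLeaf`: c₀ = 64), tree decay at the reserved rate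
`κ₁ ≥ κ₀(64, 8)`, and the cube count REPLACED by the tiling identity `hnum : |T₁^{(k)}| = (M·N)⁴` ([I] (0.26): `|π_k| =
M⁻⁴|T₁^{(k)}|`).  Conclusion: `B16.UVIneq` at every configuration with `E₋ = E₁ + ε`, `E₊ = E′ + M⁻⁴·K₀(64,8)·Σ_i
e^{−c_i}`.  The remaining hypotheses (leaf H, U1 with the injective indexing `fam` and the majorisation, L1, the
all-small form, `hχ`, the lower (2.49) bookkeeping `hA'`, (1.100) summed `hR`) are those of gen 3 verbatim. [cite: Balaban1989LargeFieldII, (0.1) p.356 and p.387 after (1.89)] -/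
theorem uvIneq_of_structure_classes_torus (D : B16.RunData) (k : ℕ) (R : B14Cor3.TermData D k)
    (N : ℕ) [NeZero N] {M : ℝ} (hM : M ≠ 0) (hnum : (D.numSites k : ℝ) = (M * N) ^ 4)
    {κ₁ : ℝ} (hκ : B12TreeDecay.kappa₀ (4 * 2 ^ 4) (2 * 4) ≤ κ₁)
    {m : ℕ} (c : Fin m → ℝ)
    (fam : R.Adm → Finset (Fin m × (tsys 4 N).Dom)) (A' Rre : D.Cfg k → ℝ) (E₁ ε E' : ℝ)
    (hH : R.Holds)
    (hU1 : ∀ a V, R.term a V ≤ R.major a)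
    (hinj : Function.Injective fam)
    (hmaj : ∀ a, R.major a ≤ Real.exp (E' * (D.numSites k : ℝ)) *
      ∏ t ∈ fam a, Real.exp (-(c t.1) - κ₁ * (tsys 4 N).dj t.2))
    (hL1 : ∀ a V, 0 ≤ R.term a V)
    (hform : ∀ V, R.term R.allSmall V = D.χ k V * Real.exp (A' V + Rre V))
    (hχ : ∀ V, 0 ≤ D.χ k V)
    (hA' : ∀ V, D.χ k V ≠ 0 →
      -(1 / (D.flow.g k) ^ 2 * D.wilsonBG k V) - E₁ * (D.numSites k : ℝ) ≤ A' V)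
    (hR : ∀ V, |Rre V| ≤ ε * (D.numSites k : ℝ)) :
    ∀ V : D.Cfg k, B16.UVIneq D k V (E₁ + ε)
      (E' + M⁻¹ ^ 4 * B12TreeDecay.K₀ (4 * 2 ^ 4) (2 * 4) * ∑ i, Real.exp (-(c i))) :=
  B16Cor3Scales.uvIneq_of_structure_classes D k R (tsys 4 N) (tcubeSys 4 N) (tdegreeLE 4 N) (tvolumeLeaf 4 N) hκ
    c (M⁻¹ ^ 4) (cubeCount_torus N hM hnum) fam A' Rre E₁ ε E' hH hU1 hinj hmaj hL1 hform hχ hA' hR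

/-- **(2.50)/(0.1), one run, one step, from (1.72) + (1.73), ON THE TORUS** — gen 4's
`B16Cor3Ops.Repr172.uvIneq_of_repr172` (two classes: the components of `Z_k` with small factor `e^{−c 0}`, the `Y_i`
with `e^{−c 1}`, tree decay `e^{−κ₁d_k}`) with the domains of step k realised as the torus catalogue `tsys 4 N`, the
geometry DISCHARGED (Δ = 8, c₀ = 64, `κ₁ ≥ κ₀(64,8)`) and the cube count REPLACED by `hnum : |T₁^{(k)}| = (M·N)⁴`.
Remaining hypotheses verbatim as in gen 4: (1.72) holds for the density (`hH`), `hχ01`, `h0χ`, the factor leaves `hZ`,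
`hY`, `hA'up`, `hcurly`, `h0c`, `hR`, the lower (2.49) bookkeeping `hA'`.  Conclusion: `B16.UVIneq` with `E₋ = E₁ + ε`,
`E₊ = E′ + ε′ + M⁻⁴·K₀(64,8)·Σ_{i<2} e^{−c i}`. [cite: Balaban1989LargeFieldII, (0.1) p.356 and p.387 after (1.89)] -/
theorem uvIneq_of_repr172_torus (D : B16.RunData) (k : ℕ) (N : ℕ) [NeZero N]
    (R : Repr172 (D.Cfg k) (tsys 4 N).Dom)
    {M : ℝ} (hM : M ≠ 0) (hnum : (D.numSites k : ℝ) = (M * N) ^ 4)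
    {κ₁ : ℝ} (hκ : B12TreeDecay.kappa₀ (4 * 2 ^ 4) (2 * 4) ≤ κ₁)
    (c : Fin 2 → ℝ) (Rre : D.Cfg k → ℝ) (E₁ ε ε' E' : ℝ)
    (hH : R.Holds (D.ρ k))
    (hχ01 : ∀ a V, 0 ≤ R.χ a V ∧ R.χ a V ≤ 1)
    (h0χ : ∀ V, R.χ R.allSmall V = D.χ k V)
    (hZ : ∀ a V, (R.TZ a).T 1 V ≤ ∏ X ∈ R.Zc a, Real.exp (-(c 0) - κ₁ * (tsys 4 N).dj X))
    (hY : ∀ a V, (R.TYs a).T 1 V ≤ ∏ Y ∈ R.Ys a, Real.exp (-(c 1) - κ₁ * (tsys 4 N).dj Y))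
    (hA'up : ∀ V, R.A' V ≤ E' * (D.numSites k : ℝ))
    (hcurly : ∀ a V, 0 ≤ R.curly a V ∧ R.curly a V ≤ Real.exp (ε' * (D.numSites k : ℝ)))
    (h0c : ∀ V, R.curly R.allSmall V = Real.exp (Rre V))
    (hR : ∀ V, |Rre V| ≤ ε * (D.numSites k : ℝ))
    (hA' : ∀ V, D.χ k V ≠ 0 →
      -(1 / (D.flow.g k) ^ 2 * D.wilsonBG k V) - E₁ * (D.numSites k : ℝ) ≤ R.A' V) :
    ∀ V : D.Cfg k, B16.UVIneq D k V (E₁ + ε)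
      (E' + ε' + M⁻¹ ^ 4 * B12TreeDecay.K₀ (4 * 2 ^ 4) (2 * 4) * ∑ i, Real.exp (-(c i))) :=
  Repr172.uvIneq_of_repr172 D k (tsys 4 N) R (tcubeSys 4 N) (tdegreeLE 4 N) (tvolumeLeaf 4 N) hκ c (M⁻¹ ^ 4)
    (cubeCount_torus N hM hnum) Rre E₁ ε ε' E' hH hχ01 h0χ hZ hY hA'up hcurly h0c hR hA'

/-- **(2.50)/(0.1), one run, one step — Wilson form, ON THE TORUS** — gen 5's `B16Cor3Wilson.uvIneq_of_repr172_wilson`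
(the `Z_k`-operation is the composite of its component operations `hTZ`, the components pull out the Boltzmann factors
of the other components `hpull`, each weighs its own by `exp(−c 0 − κ₁d_k(X))` `hw` — p. 387 *"the inequality (1.79)
holds for the 𝐓-operation connected with an arbitrary large field region … an improved bound (1.89), with the additional
term −κ₁d_k(X) in the exponential"* —, the split `exp A′_k ≤ e^{E′N}·Π_{X∈Z_k} B_X` `hsplit`) with the domains of step k
realised as the torus catalogue `tsys 4 N`, the geometry DISCHARGED (Δ = 8, c₀ = 64, `κ₁ ≥ κ₀(64,8)`) and the cube count
REPLACED by `hnum : |T₁^{(k)}| = (M·N)⁴`; every other hypothesis and the conclusion (`E₋ = E₁ + ε`, `E₊ = E′ + ε′ +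
M⁻⁴·K₀(64,8)·Σ_{i<2} e^{−c i}`) verbatim as in gen 5. [cite: Balaban1989LargeFieldII, (0.1) p.356 and p.387 after (1.89)] -/
theorem uvIneq_of_repr172_wilson_torus (D : B16.RunData) (k : ℕ) (N : ℕ) [NeZero N]
    (R : Repr172 (D.Cfg k) (tsys 4 N).Dom)
    {M : ℝ} (hM : M ≠ 0) (hnum : (D.numSites k : ℝ) = (M * N) ^ 4)
    {κ₁ : ℝ} (hκ : B12TreeDecay.kappa₀ (4 * 2 ^ 4) (2 * 4) ≤ κ₁)
    (c : Fin 2 → ℝ) (Rre : D.Cfg k → ℝ) (E₁ ε ε' E' : ℝ)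
    (hH : R.Holds (D.ρ k))
    (hχ01 : ∀ a V, 0 ≤ R.χ a V ∧ R.χ a V ≤ 1)
    (h0χ : ∀ V, R.χ R.allSmall V = D.χ k V)
    (T : R.Adm → (tsys 4 N).Dom → PosOp (D.Cfg k)) (l : R.Adm → List (tsys 4 N).Dom)
    (hnd : ∀ a, (l a).Nodup) (hset : ∀ a, (l a).toFinset = R.Zc a)
    (hTZ : ∀ a F V, (R.TZ a).T F V = (PosOp.pi (T a) (l a)).T F V)
    (B : R.Adm → (tsys 4 N).Dom → D.Cfg k → ℝ)
    (hB : ∀ a, ∀ X ∈ R.Zc a, ∀ V, 0 ≤ B a X V)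
    (hpull : ∀ a, ∀ X ∈ R.Zc a, ∀ X' ∈ R.Zc a, X ≠ X' → Pull (T a X) (B a X'))
    (hw : ∀ a, ∀ X ∈ R.Zc a, ∀ V, (T a X).T (B a X) V ≤ Real.exp (-(c 0) - κ₁ * (tsys 4 N).dj X))
    (hsplit : ∀ a V, Real.exp (R.A' V) ≤ Real.exp (E' * (D.numSites k : ℝ)) * ∏ X ∈ R.Zc a, B a X V)
    (hY : ∀ a V, (R.TYs a).T 1 V ≤ ∏ Y ∈ R.Ys a, Real.exp (-(c 1) - κ₁ * (tsys 4 N).dj Y))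
    (hcurly : ∀ a V, 0 ≤ R.curly a V ∧ R.curly a V ≤ Real.exp (ε' * (D.numSites k : ℝ)))
    (h0c : ∀ V, R.curly R.allSmall V = Real.exp (Rre V))
    (hR : ∀ V, |Rre V| ≤ ε * (D.numSites k : ℝ))
    (hA' : ∀ V, D.χ k V ≠ 0 →
      -(1 / (D.flow.g k) ^ 2 * D.wilsonBG k V) - E₁ * (D.numSites k : ℝ) ≤ R.A' V) :
    ∀ V : D.Cfg k, B16.UVIneq D k V (E₁ + ε)
      (E' + ε' + M⁻¹ ^ 4 * B12TreeDecay.K₀ (4 * 2 ^ 4) (2 * 4) * ∑ i, Real.exp (-(c i))) :=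
  uvIneq_of_repr172_wilson D k (tsys 4 N) R (tcubeSys 4 N) (tdegreeLE 4 N) (tvolumeLeaf 4 N) hκ c (M⁻¹ ^ 4)
    (cubeCount_torus N hM hnum) Rre E₁ ε ε' E' hH hχ01 h0χ T l hnd hset hTZ B hB hpull hw hsplit hY hcurly h0c hR hA'

/-- **(2.50)/(0.1), one run, one step — the exponential split made explicit, ON THE TORUS** — gen 5's
`B16Cor3Wilson.uvIneq_of_repr172_wilsonSplit` (Boltzmann factors `B_X = exp(−Σ_{p∈plaq X} e_p)`, Wilson decomposition
`A′_k = rest − Σ_{p∈P} e_p` with `e_p ≥ 0`, disjoint plaquette families per component, `rest ≤ E′N`, localization law,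
per-component Gaussian bound `T_X[B_X] ≤ exp(−c 0 − κ₁d_k(X))`) with the domains of step k realised as the torus
catalogue `tsys 4 N`, the geometry DISCHARGED (Δ = 8, c₀ = 64, `κ₁ ≥ κ₀(64,8)`) and the cube count REPLACED by `hnum :
|T₁^{(k)}| = (M·N)⁴`; every other hypothesis and the conclusion verbatim as in gen 5. [cite: Balaban1989LargeFieldII, p.380 after (1.73) and p.387 after (1.89)] -/
theorem uvIneq_of_repr172_wilsonSplit_torus (D : B16.RunData) (k : ℕ) (N : ℕ) [NeZero N]
    (R : Repr172 (D.Cfg k) (tsys 4 N).Dom)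
    {M : ℝ} (hM : M ≠ 0) (hnum : (D.numSites k : ℝ) = (M * N) ^ 4)
    {κ₁ : ℝ} (hκ : B12TreeDecay.kappa₀ (4 * 2 ^ 4) (2 * 4) ≤ κ₁)
    (c : Fin 2 → ℝ) (Rre : D.Cfg k → ℝ) (E₁ ε ε' E' : ℝ)
    (hH : R.Holds (D.ρ k))
    (hχ01 : ∀ a V, 0 ≤ R.χ a V ∧ R.χ a V ≤ 1)
    (h0χ : ∀ V, R.χ R.allSmall V = D.χ k V)
    (T : R.Adm → (tsys 4 N).Dom → PosOp (D.Cfg k)) (l : R.Adm → List (tsys 4 N).Dom)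
    (hnd : ∀ a, (l a).Nodup) (hset : ∀ a, (l a).toFinset = R.Zc a)
    (hTZ : ∀ a F V, (R.TZ a).T F V = (PosOp.pi (T a) (l a)).T F V)
    {Pl : Type*} [DecidableEq Pl] (rest : D.Cfg k → ℝ) (P : Finset Pl) (e : Pl → D.Cfg k → ℝ)
    (he : ∀ p ∈ P, ∀ V, 0 ≤ e p V) (hA : ∀ V, R.A' V = rest V - ∑ p ∈ P, e p V)
    (plaq : R.Adm → (tsys 4 N).Dom → Finset Pl) (hsub : ∀ a, ∀ X ∈ R.Zc a, plaq a X ⊆ P)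
    (hdisj : ∀ a, (R.Zc a : Set (tsys 4 N).Dom).PairwiseDisjoint (plaq a))
    (hrest : ∀ V, rest V ≤ E' * (D.numSites k : ℝ))
    (hpull : ∀ a, ∀ X ∈ R.Zc a, ∀ X' ∈ R.Zc a, X ≠ X' →
      Pull (T a X) (fun V => Real.exp (-(∑ p ∈ plaq a X', e p V))))
    (hw : ∀ a, ∀ X ∈ R.Zc a, ∀ V,
      (T a X).T (fun V => Real.exp (-(∑ p ∈ plaq a X, e p V))) V ≤ Real.exp (-(c 0) - κ₁ * (tsys 4 N).dj X))
    (hY : ∀ a V, (R.TYs a).T 1 V ≤ ∏ Y ∈ R.Ys a, Real.exp (-(c 1) - κ₁ * (tsys 4 N).dj Y))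
    (hcurly : ∀ a V, 0 ≤ R.curly a V ∧ R.curly a V ≤ Real.exp (ε' * (D.numSites k : ℝ)))
    (h0c : ∀ V, R.curly R.allSmall V = Real.exp (Rre V))
    (hR : ∀ V, |Rre V| ≤ ε * (D.numSites k : ℝ))
    (hA' : ∀ V, D.χ k V ≠ 0 →
      -(1 / (D.flow.g k) ^ 2 * D.wilsonBG k V) - E₁ * (D.numSites k : ℝ) ≤ R.A' V) :
    ∀ V : D.Cfg k, B16.UVIneq D k V (E₁ + ε)
      (E' + ε' + M⁻¹ ^ 4 * B12TreeDecay.K₀ (4 * 2 ^ 4) (2 * 4) * ∑ i, Real.exp (-(c i))) :=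
  uvIneq_of_repr172_wilsonSplit D k (tsys 4 N) R (tcubeSys 4 N) (tdegreeLE 4 N) (tvolumeLeaf 4 N) hκ c (M⁻¹ ^ 4)
    (cubeCount_torus N hM hnum) Rre E₁ ε ε' E' hH hχ01 h0χ T l hnd hset hTZ rest P e he hA plaq hsub hdisj hrest
    hpull hw hY hcurly h0c hR hA'

/-! ## 3. Reading (β) on the tori of all ages: gen 3's k-uniform entropy constant with the geometry discharged -/

/-- **(2.50)/(0.1), one run, one step, reading (β), ON THE TORI OF ALL AGES** — `B16Cor3Scales.uvIneq_of_structure_scales`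
with the localization domains of age `m` (birth scale `j = k − m`) realised as the torus catalogue `tsys 4 (N_m)` (`N_m`
M-cubes per direction), the degree bound and the volume leaf DISCHARGED at every age with the SAME dimension-only
constants (Δ = 8, c₀ = 64; `κ₁ ≥ κ₀(64,8)`), and the cube counts REPLACED by run data: `hnum : |T₁^{(k)}| = (M·N_0)⁴` and
`hN : N_m ≤ L^m·N_0` ((0.1)/(0.26) [I]; equality for the printed lattices, `ncubes_le_pow_mul`), giving `|π_j| ≤
M⁻⁴·(L⁴)^{k−j}·|T₁^{(k)}|` (`cubeCount_scales_torus`).  Conclusion: `B16.UVIneq` at every configuration with `E₋ = E₁ +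
ε`, `E₊ = E′ + EpScales M⁻⁴ 64 8 q` — INDEPENDENT OF k.  The smallness clause `hsm` and leaf U1 (`fam`, `hinj`, `hmaj`)
are hypotheses as in gen 3. [cite: Balaban1989LargeFieldII, (0.1) p.356 and p.387 ll.8–12] -/
theorem uvIneq_of_structure_scales_torus (D : B16.RunData) (k : ℕ) (R : B14Cor3.TermData D k)
    (Nc : Fin (k + 1) → ℕ) [∀ m, NeZero (Nc m)] {M L : ℝ} (hM : M ≠ 0) (hL : 0 < L)
    (hnum : (D.numSites k : ℝ) = (M * Nc 0) ^ 4) (hN : ∀ m, (Nc m : ℝ) ≤ L ^ (m : ℕ) * Nc 0)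
    {κ₁ : ℝ} (hκ₁ : B12TreeDecay.kappa₀ (4 * 2 ^ 4) (2 * 4) ≤ κ₁)
    (live : (m : Fin (k + 1)) → Finset (tsys 4 (Nc m)).Dom) (c : Fin (k + 1) → ℝ) (κ q : ℝ)
    (hsm : B16Cor3Scales.Smallness (fun m => tsys 4 (Nc m)) live c κ κ₁ (L ^ 4) q)
    (fam : R.Adm → Finset (B16Cor3Scales.Tok (fun m => tsys 4 (Nc m)) live)) (A' Rre : D.Cfg k → ℝ)
    (E₁ ε E' : ℝ)
    (hH : R.Holds)
    (hU1 : ∀ a V, R.term a V ≤ R.major a)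
    (hinj : Function.Injective fam)
    (hmaj : ∀ a, R.major a ≤ Real.exp (E' * (D.numSites k : ℝ)) *
      ∏ t ∈ fam a, B16Cor3Scales.wt (fun m => tsys 4 (Nc m)) live c κ t)
    (hL1 : ∀ a V, 0 ≤ R.term a V)
    (hform : ∀ V, R.term R.allSmall V = D.χ k V * Real.exp (A' V + Rre V))
    (hχ : ∀ V, 0 ≤ D.χ k V)
    (hA' : ∀ V, D.χ k V ≠ 0 →
      -(1 / (D.flow.g k) ^ 2 * D.wilsonBG k V) - E₁ * (D.numSites k : ℝ) ≤ A' V)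
    (hR : ∀ V, |Rre V| ≤ ε * (D.numSites k : ℝ)) :
    ∀ V : D.Cfg k, B16.UVIneq D k V (E₁ + ε)
      (E' + B16Cor3Scales.EpScales (M⁻¹ ^ 4) (4 * 2 ^ 4) (2 * 4) q) :=
  B16Cor3Scales.uvIneq_of_structure_scales D k R (fun m => tsys 4 (Nc m)) (fun m => tcubeSys 4 (Nc m))
    (fun m => tdegreeLE 4 (Nc m)) (fun m => tvolumeLeaf 4 (Nc m)) hκ₁ live c κ (L ^ 4) q (M⁻¹ ^ 4)
    (by positivity) (by positivity) (cubeCount_scales_torus Nc hM hnum hN) hsm fam A' Rre E₁ ε E' hH hU1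
    hinj hmaj hL1 hform hχ hA' hR

/-- **Reading (β) from a horizon, ON THE TORI OF ALL AGES** — `B16Cor3Scales.uvIneq_of_structure_horizon` (the
smallness clause DISCHARGED by the liveness horizon `hlive`, the small factors left to live tokens `hc`, the reserve
`(log Λ + 1)b ≤ κ − κ₁`) with the domains of every age realised as torus catalogues, the geometry DISCHARGED (Δ = 8,
c₀ = 64, `κ₁ ≥ κ₀(64,8)`), `Λ = L⁴` with `L ≥ 1`, and the cube counts REPLACED by the run data `hnum`, `hN` as in
`uvIneq_of_structure_scales_torus`.  Conclusion: `B16.UVIneq` with `E₋ = E₁ + ε`, `E₊ = E′ + EpScales M⁻⁴ 64 8 q`.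
[cite: Balaban1989LargeFieldII, (0.1) p.356 and p.385] -/
theorem uvIneq_of_structure_horizon_torus (D : B16.RunData) (k : ℕ) (R : B14Cor3.TermData D k)
    (Nc : Fin (k + 1) → ℕ) [∀ m, NeZero (Nc m)] {M L : ℝ} (hM : M ≠ 0) (hL : 1 ≤ L)
    (hnum : (D.numSites k : ℝ) = (M * Nc 0) ^ 4) (hN : ∀ m, (Nc m : ℝ) ≤ L ^ (m : ℕ) * Nc 0)
    {κ₁ : ℝ} (hκ₁ : B12TreeDecay.kappa₀ (4 * 2 ^ 4) (2 * 4) ≤ κ₁)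
    (live : (m : Fin (k + 1)) → Finset (tsys 4 (Nc m)).Dom) (c : Fin (k + 1) → ℝ) (κ q a b : ℝ)
    (H : Fin (k + 1) → ℝ)
    (hlive : ∀ (m : Fin (k + 1)) (Y : (tsys 4 (Nc m)).Dom), Y ∈ live m →
      ((m : ℕ) : ℝ) ≤ a + b * (tsys 4 (Nc m)).dj Y + H m)
    (hc : ∀ m : Fin (k + 1), (Real.log (L ^ 4) + 1) * (a + H m) + q ≤ c m)
    (hκ : (Real.log (L ^ 4) + 1) * b ≤ κ - κ₁)
    (fam : R.Adm → Finset (B16Cor3Scales.Tok (fun m => tsys 4 (Nc m)) live)) (A' Rre : D.Cfg k → ℝ)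
    (E₁ ε E' : ℝ)
    (hH : R.Holds)
    (hU1 : ∀ a V, R.term a V ≤ R.major a)
    (hinj : Function.Injective fam)
    (hmaj : ∀ a, R.major a ≤ Real.exp (E' * (D.numSites k : ℝ)) *
      ∏ t ∈ fam a, B16Cor3Scales.wt (fun m => tsys 4 (Nc m)) live c κ t)
    (hL1 : ∀ a V, 0 ≤ R.term a V)
    (hform : ∀ V, R.term R.allSmall V = D.χ k V * Real.exp (A' V + Rre V))
    (hχ : ∀ V, 0 ≤ D.χ k V)
    (hA' : ∀ V, D.χ k V ≠ 0 →
      -(1 / (D.flow.g k) ^ 2 * D.wilsonBG k V) - E₁ * (D.numSites k : ℝ) ≤ A' V)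
    (hR : ∀ V, |Rre V| ≤ ε * (D.numSites k : ℝ)) :
    ∀ V : D.Cfg k, B16.UVIneq D k V (E₁ + ε)
      (E' + B16Cor3Scales.EpScales (M⁻¹ ^ 4) (4 * 2 ^ 4) (2 * 4) q) :=
  B16Cor3Scales.uvIneq_of_structure_horizon D k R (fun m => tsys 4 (Nc m)) (fun m => tcubeSys 4 (Nc m))
    (fun m => tdegreeLE 4 (Nc m)) (fun m => tvolumeLeaf 4 (Nc m)) hκ₁ live c κ (L ^ 4) q (M⁻¹ ^ 4) a b H
    (one_le_pow₀ hL) (by positivity) (cubeCount_scales_torus Nc hM hnum hN) hlive hc hκ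
    fam A' Rre E₁ ε E' hH hU1 hinj hmaj hL1 hform hχ hA' hR

end Literature.MathematicalPhysics.QuantumFieldTheory.Balaban1983to89.B16Cor3Torus

end
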